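import Literature.Computability.QuantumComplexity.GRData
import Literature.Computability.QuantumComplexity.CoreDescBlockFP
import HarnessLib

/-!
# The data positions of the Grover–Rudolph levels in closed form, and on codes

Topic `Literature/Computability/QuantumComplexity`; an input of the S3 stage word of the UNIFORMITY of Regev's sampler
([Regev2009, Lemma 3.14, proof]; Arora–Barak §6.2): the level word `GRStage.levelA D j` (`GRStageAbstract.lean`) relabels the clean
cosine block by `CleanPlaced.relabel (j + np) (GRBlock.dposP ws pw j) D.base`, and the stage lemma `GRStage.levelsA_codeFP_of`
(`GRLevelWordDesc.lean`) asks for the data-position FUNCTION `dpos c j : ℕ → ℕ` on codes in the shape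
`CodeFP (pairE (pairE eσ natE) natE) natE (fun q => dpos q.1.1 q.1.2 q.2)`. For the standard point/parameter registers of `GRData.lean`
(`ws j = j`, `pw t = ℓ + t`, `GRData.dposP_eq` on the window) the function is, on ALL of `ℕ`,

  `dposStd ℓ np j i = if i < j then (if i < ℓ then i else 0) else if i − j < np then ℓ + (i − j) else 0`

(`GRData.dposP_eq_dposStd`, an equality of functions `GRBlock.dposP (ws …) (pw …) j = dposStd ℓ np j`), and `dposStd` is polynomial-time on
codes in exactly the requested shape (`GRData.dposStd_codeFP_of`); the base `D.base = ℓ + np` of `GRData.data` is `GRData.baseStd_codeFP_of`.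
Everything is proved; no named fact is introduced.

## References

* O. Regev, J. ACM 56(6) (2009), Lemma 3.12 (proof), Lemma 3.14 (proof) [Regev2009].
* S. Arora, B. Barak, *Computational Complexity: A Modern Approach*, CUP 2009, §6.2 [AroraBarak2009].
-/

noncomputable section

namespace Literature.Computability.QuantumComplexity

open _root_.Computability Cryptography Complexity Complexity.CodeFP SLP RevDesc AJLCore

namespace GRData

/-- **The standard data-position function of level `j`** (on all of `ℕ`). [folklore] -/
def dposStd (ℓ np j i : ℕ) : ℕ := if i < j then (if i < ℓ then i else 0) else if i - j < np then ℓ + (i - j) else 0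

/-- **The data positions of the standard registers are `dposStd`**, as functions. [folklore] -/
theorem dposP_eq_dposStd (ℓ np wlen kk j : ℕ) : GRBlock.dposP (ws ℓ np wlen kk) (pw ℓ np wlen kk) j = dposStd ℓ np j := by
  funext i
  unfold GRBlock.dposP GRBlock.dposOf dposStd
  by_cases h : i < j
  · rw [if_pos h, if_pos h]
    by_cases hi : i < ℓ
    · rw [dif_pos hi, if_pos hi, ws_val]
    · rw [dif_neg hi, if_neg hi]
  · rw [if_neg h, if_neg h]
    by_cases hi : i - j < np
    · rw [dif_pos hi, if_pos hi, pw_val]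
    · rw [dif_neg hi, if_neg hi]

/-- On the data window the closed form is the one of `GRData.dposP_eq`. [folklore] -/
theorem dposStd_of_lt {ℓ np j i : ℕ} (hj : j ≤ ℓ) (hi : i < j + np) : dposStd ℓ np j i = if i < j then i else ℓ + (i - j) := by
  unfold dposStd
  by_cases h : i < j
  · rw [if_pos h, if_pos h, if_pos (lt_of_lt_of_le h hj)]
  · rw [if_neg h, if_neg h, if_pos (by omega)]

variable {σ : Type} {eσ : σ → List Bool} {ℓ np : σ → ℕ} (hℓ : CodeFP eσ unE ℓ) (hnp : CodeFP eσ unE np)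
include hℓ hnp

/-- **The standard data positions on codes**, in the shape `GRStage.levelsA_codeFP_of` consumes (context, level `j`, wire `i`).
[cite: Regev2009, Lemma 3.14 (proof)] [cite: AroraBarak2009, §6.2 (proof of Thm. 6.15)] -/
theorem dposStd_codeFP_of : CodeFP (pairE (pairE eσ natE) natE) natE (fun q => dposStd (ℓ q.1.1) (np q.1.1) q.1.2 q.2) := by
  have I : CodeFP (pairE (pairE eσ natE) natE) natE (fun q => q.2) := snd _ _
  have J : CodeFP (pairE (pairE eσ natE) natE) natE (fun q => q.1.2) := (snd _ _).comp (fst _ _)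
  have L : CodeFP (pairE (pairE eσ natE) natE) natE (fun q => ℓ q.1.1) := BP.toNat (hℓ.comp ((fst _ _).comp (fst _ _)))
  have NP : CodeFP (pairE (pairE eσ natE) natE) natE (fun q => np q.1.1) := BP.toNat (hnp.comp ((fst _ _).comp (fst _ _)))
  have D : CodeFP (pairE (pairE eσ natE) natE) natE (fun q => q.2 - q.1.2) := natSub.comp (I.pair J)
  have h1 : CodeFP (pairE (pairE eσ natE) natE) natE (fun q => if decide (q.2 < ℓ q.1.1) then q.2 else 0) :=
    ite (natLt.comp (I.pair L)) I (const _ 0)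
  have h2 : CodeFP (pairE (pairE eσ natE) natE) natE (fun q => if decide (q.2 - q.1.2 < np q.1.1) then ℓ q.1.1 + (q.2 - q.1.2) else 0) :=
    ite (natLt.comp (D.pair NP)) (natAdd.comp (L.pair D)) (const _ 0)
  exact (ite (natLt.comp (I.pair J)) h1 h2).congr fun q => by
    unfold dposStd
    by_cases h : q.2 < q.1.2
    · rw [if_pos h, decide_eq_true h, if_pos rfl]
      by_cases h' : q.2 < ℓ q.1.1
      · rw [if_pos h', decide_eq_true h', if_pos rfl]
      · rw [if_neg h', decide_eq_false h', if_neg Bool.false_ne_true]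
    · rw [if_neg h, decide_eq_false h, if_neg Bool.false_ne_true]
      by_cases h' : q.2 - q.1.2 < np q.1.1
      · rw [if_pos h', decide_eq_true h', if_pos rfl]
      · rw [if_neg h', decide_eq_false h', if_neg Bool.false_ne_true]

/-- The base `ℓ + np` of the standard block data (`GRData.data`) on codes. [folklore] -/
theorem baseStd_codeFP_of : CodeFP eσ natE (fun c => ℓ c + np c) := natAdd.comp ((BP.toNat hℓ).pair (BP.toNat hnp))

end GRData

end Literature.Computability.QuantumComplexity

end
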